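import Summits.CriticalPhenomena.PercolationContinuityZ3.Theorems.PercAnnulusCrossingIICVolumeLowerTail
import Summits.CriticalPhenomena.PercolationContinuityZ3.Theorems.PercNearOneGluingNoHeavyRsw3IICVolumeMoments
import HarnessLib

/-!
# The mean log-volume of Kesten's planar IIC: `E_ν log|C(0) ∩ Λ(n)| = log((2n+1)² π_{1/2}(n)) + O(1)` (lane RSW3, p1 gen 16)

builds on p205010 (kernel theorem, internal audit signed; external expert review pending) — NOT used in this file (`ℤ²` at `p_c = 1/2`).

Seat `prim-rsw3-p1` (gen 16); memo `run/shared/lean/prim/rsw3/P1-QM.md` §29.  Helper file for the crux `stmt-CriticalPhenomena-4575` chain; no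
definitions, no sorries.  `V_n = #{z ∈ Λ(n) : 0 ↔ z} ≥ 1`, `σ_n = (2n+1)² π_{1/2}(n)`.  Kesten's Theorem (8) at the level of LOGARITHMS, the quantity a
census regresses: the power-law lower tail of gen 16 (`…IICVolumeLowerTail`) makes `log(σ_n/V_n)⁺` uniformly integrable, and p2 GEN 21's mean bound
`E_ν V_n ≤ C n²π(n)` controls `log(V_n/σ_n)` from above (`log x ≤ x`):

* `posPart_log_div_le_sum_indicator` — pointwise: `log(σ/V)⁺ ≤ Σ_{k<K} 𝟙{V ≤ e^{−k}σ}` for `V ≥ 1`, `σ ≤ e^K`;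
* **`iicMeasure_integral_posLog_div_volume_le_Z2`** — `∫ log(σ_n/V_n)⁺ dν ≤ C` for all `n ≥ 1` and every IIC measure `ν` at `p_c(ℤ²)`;
* **`iicMeasure_abs_integral_log_volume_sub_le_Z2`** — **`|E_ν log V_n − log σ_n| ≤ C`** uniformly in `n ≥ 1` and in `ν`: the mean log-volume of the
  IIC is `log(n²π_n) + O(1)`, so `E_ν log V_n / log n → 2 − 1/ρ` exactly when the arm exponent exists.
References: H. Kesten, PTRF 73 (1986), Thm. (8).
-/

noncomputable section

namespace Summit.CriticalPhenomena.PercolationContinuityZ3.Theorems.Crossing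

open MeasureTheory Filter Topology Literature.Probability.Percolation Literature.Probability.LatticeModels
open Literature.Probability.Percolation.DCT16 Literature.Probability.Percolation.DKT20
open scoped Literature.Probability.Percolation ENNReal

/-! ## A pointwise bound for the positive part of `log(σ/V)` -/

/-- `log(σ/V)⁺ ≤ #{k < K : V ≤ e^{−k} σ}` for `1 ≤ V` and `0 < σ ≤ e^K`. [folklore] -/
theorem posPart_log_div_le_sum_indicator {V σ : ℝ} (hV : 1 ≤ V) (hσ : 0 < σ) {K : ℕ} (hK : σ ≤ Real.exp K) :
    max (Real.log (σ / V)) 0 ≤ ∑ k ∈ Finset.range K, (if V ≤ Real.exp (-(k : ℝ)) * σ then (1 : ℝ) else 0) := by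
  have hV0 : 0 < V := by linarith
  have hsum0 : 0 ≤ ∑ k ∈ Finset.range K, (if V ≤ Real.exp (-(k : ℝ)) * σ then (1 : ℝ) else 0) :=
    Finset.sum_nonneg fun k _ => by split_ifs <;> norm_num
  rcases le_or_gt (Real.log (σ / V)) 0 with hL | hL
  · rw [max_eq_right hL]; exact hsum0
  rw [max_eq_left hL.le]
  set L := Real.log (σ / V) with hLdef
  -- `L ≤ K`
  have hLK : L ≤ K := by
    have h1 : σ / V ≤ Real.exp K := le_trans (div_le_self hσ.le hV) hK
    have := Real.log_le_log (div_pos hσ hV0) h1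
    rwa [Real.log_exp] at this
  have hceil : ⌈L⌉₊ ≤ K := Nat.ceil_le.2 hLK
  -- every `k < ⌈L⌉₊` contributes `1`
  have hterm : ∀ k ∈ Finset.range ⌈L⌉₊, (if V ≤ Real.exp (-(k : ℝ)) * σ then (1 : ℝ) else 0) = 1 := by
    intro k hk
    rw [Finset.mem_range] at hk
    have hkL : (k : ℝ) ≤ L := by
      have := Nat.lt_ceil.1 hk
      have h2 : (k : ℝ) ≤ (⌈L⌉₊ : ℝ) - 1 := by
        have : (k : ℕ) + 1 ≤ ⌈L⌉₊ := hk
        have h3 : ((k : ℕ) : ℝ) + 1 ≤ (⌈L⌉₊ : ℝ) := by exact_mod_cast this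
        linarith
      have h4 : (⌈L⌉₊ : ℝ) < L + 1 := Nat.ceil_lt_add_one hL.le
      linarith
    rw [if_pos]
    -- `k ≤ log(σ/V)` ⇒ `e^k ≤ σ/V` ⇒ `V ≤ e^{-k} σ`
    have h1 : Real.exp k ≤ σ / V := by
      calc Real.exp k ≤ Real.exp L := Real.exp_le_exp.2 hkL
        _ = σ / V := by rw [hLdef, Real.exp_log (div_pos hσ hV0)]
    rw [le_div_iff₀ hV0] at h1
    rw [Real.exp_neg, le_inv_mul_iff₀ (Real.exp_pos _)]
    exact h1
  calc L ≤ (⌈L⌉₊ : ℝ) := Nat.le_ceil L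
    _ = ∑ k ∈ Finset.range ⌈L⌉₊, (if V ≤ Real.exp (-(k : ℝ)) * σ then (1 : ℝ) else 0) := by
        rw [Finset.sum_congr rfl hterm, Finset.sum_const, Finset.card_range, nsmul_eq_mul, mul_one]
    _ ≤ _ := Finset.sum_le_sum_of_subset_of_nonneg (Finset.range_subset_range.2 hceil) fun k _ _ => by split_ifs <;> norm_num

/-! ## The positive part of `log(σ_n/V_n)` is uniformly integrable under the IIC -/

open Classical in
/-- **`∫ log(σ_n/V_n)⁺ dν ≤ C`** uniformly in `n ≥ 1` and in the IIC measure `ν` at `p_c(ℤ²)` (`σ_n = (2n+1)²π_{1/2}(n)`): the power-law lower tail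
summed over the levels `e^{−k}σ_n`. [cite: Kesten1986, Thm. (8)] -/
theorem iicMeasure_integral_posLog_div_volume_le_Z2 :
    ∃ C : ℝ, 0 < C ∧ ∀ (ν : Measure (BondConfig (Site 2))) [IsProbabilityMeasure ν],
      (∀ (F : Finset (Sym2 (Site 2))) (E : Set (BondConfig (Site 2))), MeasurableSet E → DeterminedBy E ↑F →
        Tendsto (fun n : ℕ => (bondPercolation (zdGraph 2) (criticalProbI 2)).real (E ∩ siteToBoundary 2 n) /
          oneArmProb 2 (criticalProbI 2) n) atTop (𝓝 (ν.real E))) →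
      ∀ n : ℕ, 1 ≤ n →
        ∫ ω, max (Real.log ((2 * (n : ℝ) + 1) ^ 2 * oneArmProb 2 (criticalProbI 2) n /
          ((((box 2 n).filter fun z => ω ∈ (openConn (0 : Site 2) z : Set (BondConfig (Site 2)))).card : ℕ) : ℝ))) 0 ∂ν ≤ C := by
  classical
  obtain ⟨C, c, hC, hc, htail⟩ := iicMeasure_real_volume_le_le_rpow_Z2
  have hpc0 : 0 < ((criticalProbI 2 : unitInterval) : ℝ) := by
    rw [SubpolynomialBlocking.StubBlockProbTwoPos.criticalProbI_two_eq_half, coe_half]; norm_num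
  obtain ⟨r, hr⟩ : ∃ r : ℝ, r = Real.exp (-c) := ⟨_, rfl⟩
  have hr0 : 0 < r := by rw [hr]; exact Real.exp_pos _
  have hr1 : r < 1 := by rw [hr]; exact Real.exp_lt_one_iff.2 (by linarith)
  refine ⟨C / (1 - r), div_pos hC (by linarith), fun ν _ hν n hn => ?_⟩
  set V : BondConfig (Site 2) → ℝ := fun ω =>
    ((((box 2 n).filter fun z => ω ∈ (openConn (0 : Site 2) z : Set (BondConfig (Site 2)))).card : ℕ) : ℝ) with hVdef
  have hVm : Measurable V := Rsw3.measurable_card_filter_openConn n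
  have hV1 : ∀ ω, 1 ≤ V ω := fun ω => by
    simp only [hVdef]; exact_mod_cast one_le_card_filter_openConn_zero n ω
  obtain ⟨σ, hσ⟩ : ∃ σ : ℝ, σ = (2 * (n : ℝ) + 1) ^ 2 * oneArmProb 2 (criticalProbI 2) n := ⟨_, rfl⟩
  have hσ0 : 0 < σ := by rw [hσ]; exact mul_pos (by positivity) (oneArmProb_pos (d := 2) (by norm_num) _ hpc0 n)
  set K : ℕ := ⌈Real.log σ⌉₊ with hK
  have hσK : σ ≤ Real.exp K := by
    calc σ = Real.exp (Real.log σ) := (Real.exp_log hσ0).symm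
      _ ≤ Real.exp K := Real.exp_le_exp.2 (Nat.le_ceil _)
  -- the dominating simple function
  have hmeas : ∀ k : ℕ, MeasurableSet {ω | V ω ≤ Real.exp (-(k : ℝ)) * σ} := fun k => measurableSet_le hVm measurable_const
  have hgint : Integrable (fun ω => ∑ k ∈ Finset.range K, ({ω | V ω ≤ Real.exp (-(k : ℝ)) * σ}.indicator (fun _ => (1 : ℝ)) ω)) ν :=
    integrable_finsetSum _ fun k _ => (integrable_const (1 : ℝ)).indicator (hmeas k)
  have hfg : ∀ ω, max (Real.log (σ / V ω)) 0 ≤ ∑ k ∈ Finset.range K, ({ω | V ω ≤ Real.exp (-(k : ℝ)) * σ}.indicator (fun _ => (1 : ℝ)) ω) := by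
    intro ω
    refine (posPart_log_div_le_sum_indicator (hV1 ω) hσ0 hσK).trans (le_of_eq ?_)
    refine Finset.sum_congr rfl fun k _ => ?_
    by_cases h : V ω ≤ Real.exp (-(k : ℝ)) * σ
    · rw [if_pos h, Set.indicator_of_mem (by exact h)]
    · rw [if_neg h, Set.indicator_of_notMem (by exact h)]
  have hfm : AEStronglyMeasurable (fun ω => max (Real.log (σ / V ω)) 0) ν :=
    ((Real.measurable_log.comp (measurable_const.div hVm)).max measurable_const).aestronglyMeasurable
  have hfint : Integrable (fun ω => max (Real.log (σ / V ω)) 0) ν :=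
    hgint.mono' hfm (Filter.Eventually.of_forall fun ω => by
      rw [Real.norm_eq_abs, abs_of_nonneg (le_max_right _ _)]; exact hfg ω)
  -- integrate
  have hint_g : ∫ ω, ∑ k ∈ Finset.range K, ({ω | V ω ≤ Real.exp (-(k : ℝ)) * σ}.indicator (fun _ => (1 : ℝ)) ω) ∂ν =
      ∑ k ∈ Finset.range K, ν.real {ω | V ω ≤ Real.exp (-(k : ℝ)) * σ} := by
    rw [integral_finsetSum (Finset.range K) (f := fun k ω => ({ω | V ω ≤ Real.exp (-(k : ℝ)) * σ}.indicator (fun _ => (1 : ℝ)) ω))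
      fun k _ => (integrable_const (1 : ℝ)).indicator (hmeas k)]
    refine Finset.sum_congr rfl fun k _ => ?_
    rw [integral_indicator (hmeas k), setIntegral_const, smul_eq_mul, mul_one]
  have hk : ∀ k : ℕ, ν.real {ω | V ω ≤ Real.exp (-(k : ℝ)) * σ} ≤ C * r ^ k := by
    intro k
    have h := htail ν hν n hn (Real.exp (-(k : ℝ))) (Real.exp_pos _)
    have hrk : Real.exp (-(k : ℝ)) ^ c = r ^ k := by
      rw [hr, ← Real.exp_mul, ← Real.exp_nat_mul]; ring_nf
    have hset : {ω | V ω ≤ Real.exp (-(k : ℝ)) * σ} = {ω | ((((box 2 n).filter fun z =>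
        ω ∈ (openConn (0 : Site 2) z : Set (BondConfig (Site 2)))).card : ℕ) : ℝ) ≤
          Real.exp (-(k : ℝ)) * (2 * (n : ℝ) + 1) ^ 2 * oneArmProb 2 (criticalProbI 2) n} := by
      ext ω; simp only [Set.mem_setOf_eq, hVdef, hσ, mul_assoc]
    rw [hset, ← hrk]
    exact h
  have hgeom : ∑ k ∈ Finset.range K, C * r ^ k ≤ C / (1 - r) := by
    rw [← Finset.mul_sum, le_div_iff₀ (by linarith)]
    have h1 : (∑ k ∈ Finset.range K, r ^ k) * (1 - r) = 1 - r ^ K := by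
      have := geom_sum_mul_neg r K
      linarith [this]
    have hrK : 0 ≤ r ^ K := pow_nonneg hr0.le K
    calc C * (∑ k ∈ Finset.range K, r ^ k) * (1 - r) = C * (1 - r ^ K) := by rw [mul_assoc, h1]
      _ ≤ C := by nlinarith
  rw [← hσ]
  change ∫ ω, max (Real.log (σ / V ω)) 0 ∂ν ≤ C / (1 - r)
  calc ∫ ω, max (Real.log (σ / V ω)) 0 ∂ν
      ≤ ∫ ω, ∑ k ∈ Finset.range K, ({ω | V ω ≤ Real.exp (-(k : ℝ)) * σ}.indicator (fun _ => (1 : ℝ)) ω) ∂ν :=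
        integral_mono hfint hgint hfg
    _ = ∑ k ∈ Finset.range K, ν.real {ω | V ω ≤ Real.exp (-(k : ℝ)) * σ} := hint_g
    _ ≤ ∑ k ∈ Finset.range K, C * r ^ k := Finset.sum_le_sum fun k _ => hk k
    _ ≤ C / (1 - r) := hgeom

/-! ## `E_ν log V_n = log σ_n + O(1)` -/

open Classical in
/-- **THE MEAN LOG-VOLUME OF KESTEN'S PLANAR IIC IS `log((2n+1)²π_{1/2}(n)) + O(1)`**: there is `C` such that for every measure `ν` with Kesten's IIC
limit property at `p_c(ℤ²) = 1/2` and all `n ≥ 1`: **`|∫ log|C(0) ∩ Λ(n)| dν − log((2n+1)² π_{1/2}(n))| ≤ C`** (lower side: the uniformly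
integrable `log(σ/V)⁺`; upper side: `log x ≤ x` and `E_ν V_n ≤ C n²π(n)`, p2 GEN 21).  Consequently `E_ν log V_n / log n` converges iff the bond
one-arm exponent exists, and then to `2 − 1/ρ`. [cite: Kesten1986, Thm. (8)] -/
theorem iicMeasure_abs_integral_log_volume_sub_le_Z2 :
    ∃ C : ℝ, 0 < C ∧ ∀ (ν : Measure (BondConfig (Site 2))) [IsProbabilityMeasure ν],
      (∀ (F : Finset (Sym2 (Site 2))) (E : Set (BondConfig (Site 2))), MeasurableSet E → DeterminedBy E ↑F →
        Tendsto (fun n : ℕ => (bondPercolation (zdGraph 2) (criticalProbI 2)).real (E ∩ siteToBoundary 2 n) /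
          oneArmProb 2 (criticalProbI 2) n) atTop (𝓝 (ν.real E))) →
      ∀ n : ℕ, 1 ≤ n →
        |(∫ ω, Real.log ((((box 2 n).filter fun z => ω ∈ (openConn (0 : Site 2) z : Set (BondConfig (Site 2)))).card : ℕ) : ℝ) ∂ν) -
          Real.log ((2 * (n : ℝ) + 1) ^ 2 * oneArmProb 2 (criticalProbI 2) n)| ≤ C := by
  classical
  obtain ⟨C₁, hC₁, hlow⟩ := iicMeasure_integral_posLog_div_volume_le_Z2
  obtain ⟨ϰ, hϰ, hA2⟩ := exists_setToSetQuasiMultAspectAt_two_of_criticalProbI_le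
  obtain ⟨C₂, hC₂, hup⟩ := Rsw3.iicMeasure_integral_volume_pow_le (d := 2) le_rfl (by norm_num) (by norm_num) hϰ (hA2 _ le_rfl) 0
  have hpc0 : 0 < ((criticalProbI 2 : unitInterval) : ℝ) := by
    rw [SubpolynomialBlocking.StubBlockProbTwoPos.criticalProbI_two_eq_half, coe_half]; norm_num
  refine ⟨max C₁ C₂, lt_max_of_lt_left hC₁, fun ν _ hν n hn => ?_⟩
  set V : BondConfig (Site 2) → ℝ := fun ω =>
    ((((box 2 n).filter fun z => ω ∈ (openConn (0 : Site 2) z : Set (BondConfig (Site 2)))).card : ℕ) : ℝ) with hVdef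
  have hVm : Measurable V := Rsw3.measurable_card_filter_openConn n
  have hV1 : ∀ ω, 1 ≤ V ω := fun ω => by
    simp only [hVdef]; exact_mod_cast one_le_card_filter_openConn_zero n ω
  have hVle : ∀ ω, V ω ≤ ((box 2 n).card : ℝ) := fun ω => by
    simp only [hVdef]; exact_mod_cast Finset.card_filter_le _ _
  obtain ⟨σ, hσ⟩ : ∃ σ : ℝ, σ = (2 * (n : ℝ) + 1) ^ 2 * oneArmProb 2 (criticalProbI 2) n := ⟨_, rfl⟩
  have hπ0 : 0 < oneArmProb 2 (criticalProbI 2) n := oneArmProb_pos (d := 2) (by norm_num) _ hpc0 n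
  have hσ0 : 0 < σ := by rw [hσ]; exact mul_pos (by positivity) hπ0
  have hn0 : (0 : ℝ) < n := by exact_mod_cast hn
  -- integrability of the bounded measurable functions involved
  have hbox : (1 : ℝ) ≤ ((box 2 n).card : ℝ) := (hV1 ∅).trans (hVle ∅)
  have hlogV_int : Integrable (fun ω => Real.log (V ω)) ν := by
    refine Integrable.of_bound (C := Real.log ((box 2 n).card : ℝ)) ((Real.measurable_log.comp hVm).aestronglyMeasurable)
      (Filter.Eventually.of_forall fun ω => ?_)
    rw [Real.norm_eq_abs, abs_of_nonneg (Real.log_nonneg (hV1 ω))]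
    exact Real.log_le_log (by linarith [hV1 ω]) (hVle ω)
  have hV_int : Integrable V ν := by
    refine Integrable.of_bound (C := ((box 2 n).card : ℝ)) hVm.aestronglyMeasurable (Filter.Eventually.of_forall fun ω => ?_)
    rw [Real.norm_eq_abs, abs_of_nonneg (by linarith [hV1 ω])]
    exact hVle ω
  -- `∫ log V − log σ = ∫ log (V/σ)`
  have hlogdiv : (fun ω => Real.log (V ω / σ)) = fun ω => Real.log (V ω) - Real.log σ := by
    funext ω; rw [Real.log_div (by linarith [hV1 ω]) hσ0.ne']
  have hlogdiv_int : Integrable (fun ω => Real.log (V ω / σ)) ν := by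
    rw [hlogdiv]; exact hlogV_int.sub (integrable_const _)
  have hsplit : (∫ ω, Real.log (V ω) ∂ν) - Real.log σ = ∫ ω, Real.log (V ω / σ) ∂ν := by
    rw [hlogdiv, integral_sub hlogV_int (integrable_const _), integral_const, smul_eq_mul, probReal_univ, one_mul]
  -- the positive part of `log(σ/V)` is integrable (bounded by `max (log σ) 0`)
  have hf_int : Integrable (fun ω => max (Real.log (σ / V ω)) 0) ν := by
    refine Integrable.of_bound (C := max (Real.log σ) 0)
      ((Real.measurable_log.comp (measurable_const.div hVm)).max measurable_const).aestronglyMeasurable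
      (Filter.Eventually.of_forall fun ω => ?_)
    rw [Real.norm_eq_abs, abs_of_nonneg (le_max_right _ _)]
    exact max_le_max (Real.log_le_log (div_pos hσ0 (by linarith [hV1 ω])) (div_le_self hσ0.le (hV1 ω))) le_rfl
  have hflip : ∀ ω, Real.log (σ / V ω) = -Real.log (V ω / σ) := fun ω => by
    rw [Real.log_div hσ0.ne' (by linarith [hV1 ω]), Real.log_div (by linarith [hV1 ω]) hσ0.ne']; ring
  rw [show (fun ω => Real.log ((((box 2 n).filter fun z => ω ∈ (openConn (0 : Site 2) z : Set (BondConfig (Site 2)))).card : ℕ) : ℝ))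
      = fun ω => Real.log (V ω) from rfl, ← hσ, hsplit, abs_le]
  constructor
  · -- lower bound: `-C₁ ≤ -∫ log(σ/V)⁺ ≤ ∫ log(V/σ)`
    have h1 := hlow ν hν n hn
    rw [← hσ] at h1
    change ∫ ω, max (Real.log (σ / V ω)) 0 ∂ν ≤ C₁ at h1
    have h2 : ∫ ω, -max (Real.log (σ / V ω)) 0 ∂ν ≤ ∫ ω, Real.log (V ω / σ) ∂ν := by
      refine integral_mono hf_int.neg hlogdiv_int fun ω => ?_
      show -max (Real.log (σ / V ω)) 0 ≤ Real.log (V ω / σ)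
      rw [hflip ω]
      have := le_max_left (-Real.log (V ω / σ)) 0
      linarith
    rw [integral_neg] at h2
    calc -max C₁ C₂ ≤ -C₁ := neg_le_neg (le_max_left _ _)
      _ ≤ -∫ ω, max (Real.log (σ / V ω)) 0 ∂ν := neg_le_neg h1
      _ ≤ _ := h2
  · -- upper bound: `∫ log(V/σ) ≤ ∫ V/σ ≤ C₂`
    have h1 := hup ν hν n hn
    simp only [zero_add, pow_one] at h1
    change ∫ ω, V ω ∂ν ≤ C₂ * ((n : ℝ) ^ 2 * oneArmProb 2 (criticalProbI 2) n) at h1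
    have h2 : ∫ ω, Real.log (V ω / σ) ∂ν ≤ ∫ ω, V ω / σ ∂ν := by
      refine integral_mono hlogdiv_int (hV_int.div_const σ) fun ω => ?_
      show Real.log (V ω / σ) ≤ V ω / σ
      have := Real.log_le_sub_one_of_pos (x := V ω / σ) (div_pos (by linarith [hV1 ω]) hσ0)
      linarith
    have h3 : ∫ ω, V ω / σ ∂ν = (∫ ω, V ω ∂ν) / σ := integral_div σ _
    have h4 : (∫ ω, V ω ∂ν) / σ ≤ C₂ := by
      rw [div_le_iff₀ hσ0, hσ]
      refine h1.trans ?_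
      have : (n : ℝ) ^ 2 ≤ (2 * (n : ℝ) + 1) ^ 2 := pow_le_pow_left₀ hn0.le (by linarith) 2
      exact mul_le_mul_of_nonneg_left (mul_le_mul_of_nonneg_right this hπ0.le) hC₂.le
    calc ∫ ω, Real.log (V ω / σ) ∂ν ≤ C₂ := h2.trans (h3 ▸ h4)
      _ ≤ max C₁ C₂ := le_max_right _ _

end Summit.CriticalPhenomena.PercolationContinuityZ3.Theorems.Crossing

end
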